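import Literature.Topology.FourManifolds.SimplifiedBrokenLefschetzSidesGenus
import Literature.Topology.FourManifolds.SimplifiedBrokenLefschetzRoundSlicesIndex
import Literature.Topology.FourManifolds.SimplifiedBrokenLefschetzHeight
import Literature.Topology.FourManifolds.SphereHeightFoldCurves
import HarnessLib

/-!
# The angular submersion at a round point

Stub `stub_angularSubmersion` of line `Sketch`, crux `SblfDescent.RungOne`.

(Crux item stmt-SmoothPoincare4-18531; skeleton `Cruxes/RungOne/Lines/Sketch.lean`.)

Let `f : X → S²` be a genus-one simplified broken Lefschetz fibration without Lefschetz points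
(`IsSimplifiedBrokenLefschetzFibration o f ∅ 0`, Hayano 2011, Def. 2.1; Baykur–Kamada 2015, §3)
on a closed `4`-manifold whose round image `f (round locus)` is the equator
`sphereEquator 1 = {y₂ = 0}`.  At a round point `q`, write `f q = (a, b, 0)` (`a² + b² = 1`).
We prove that the "rotation angle" functional `A(y) = -b y₀ + a y₁` of `ℝ³`, restricted to the
sphere and composed with `f`, has NON-ZERO differential at `q`:
`mfderiv (A ∘ f) q ≠ 0` (`stub_angularSubmersion`).

Proof (Hayano 2011, Def. 2.1 (4), read through the tree's fold-chart calculus).  Take the fold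
chart `(φ, ψ)` at `q` given by the structure (`f = ψ⁻¹ ∘ (t, x₁² + x₂² - x₃²) ∘ φ`).  By
`isMCriticalPt_comp_iff_of_fold_chart` (Milnor 1963, §2 in the fold chart), `q` is critical for
`A ∘ f` iff `∂ₜ (A ∘ ψ⁻¹) (0) = 0`.  The axis `t ↦ φ⁻¹ (t e₀)` consists of round points
(`surjective_mfderiv_iff_of_fold_chart`), so the germ `Γ = ψ⁻¹ : ℝ² → S² ⊆ ℝ³` carries the
first axis into the equator (this is the `haxis` step of `round_point_height`); hence
`T = ∂₀Γ(0)` has `T₂ = 0` (`SphereGerm.fderiv_single_zero_two`), is tangent to the sphere at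
`f q` (`SphereGerm.inner_fderiv_eq_zero`: `a T₀ + b T₁ = 0`) and is non-zero (`ψ⁻¹` is a local
diffeomorphism and the inclusion `S² ⊆ ℝ³` is an immersion).  Since
`∂ₜ (A ∘ ψ⁻¹)(0) = A(T) = -b T₀ + a T₁`, its vanishing together with `a T₀ + b T₁ = 0` and
`a² + b² = 1` would force `T₀ = T₁ = 0`, i.e. `T = 0` — a contradiction.

## References

* K. Hayano, *On genus-1 simplified broken Lefschetz fibrations*, Algebr. Geom. Topol. 11
  (2011), Def. 2.1 (4). [Hayano2011]
* J. Milnor, *Morse theory* (1963), §2. [Milnor1963]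
-/

set_option linter.dupNamespace false

noncomputable section

open scoped Manifold ContDiff Topology RealInnerProductSpace
open Set Function Literature.Topology.FourManifolds Literature.AlgebraicTopology.SingularHomology

namespace Summit.SmoothPoincare4.SmoothPoincare4.Cruxes.RungOne.Sketch

/-- Local notation: `𝔼 n` is the model Euclidean space `EuclideanSpace ℝ (Fin n)`. -/
local notation "𝔼 " n:arg => EuclideanSpace ℝ (Fin n)

/-- Local notation: `𝕊²`, the unit sphere of `ℝ³`. -/
local notation "𝕊²" => (Metric.sphere (0 : EuclideanSpace ℝ (Fin 3)) (1 : ℝ))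

attribute [local instance] Literature.Topology.FourManifolds.fact_finrank_euclideanSpace_succ

/-- **Linear algebra of the punch line.**  If `(x, y)` is a unit vector (`x² + y² = 1`) and the
vector `(T₀, T₁)` is orthogonal both to `(x, y)` and to `(-y, x)`, then `T₀ = T₁ = 0`.
[folklore] -/
theorem eq_zero_and_eq_zero_of_orth {x y T₀ T₁ : ℝ} (hxy : x ^ 2 + y ^ 2 = 1)
    (h₁ : x * T₀ + y * T₁ = 0) (h₂ : -y * T₀ + x * T₁ = 0) : T₀ = 0 ∧ T₁ = 0 := by
  constructor
  · linear_combination x * h₁ - y * h₂ - T₀ * hxy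
  · linear_combination y * h₁ + x * h₂ - T₁ * hxy

/-- **Angular submersion at a round point.**  For a genus-one Lefschetz-free SBLF `f` on a closed
`X` whose round image is the equator, at every round point `q` (with `f q = (a, b, 0)`) the
differential of the "rotation angle" `(-b y₀ + a y₁) ∘ f` does not vanish: `df_q` has rank one
with image the tangent line of the critical image, which is the equator, and `-b y₀ + a y₁`
restricted to the sphere has non-zero derivative along the equator at `(a, b, 0)`.
(Hayano 2011, Def. 2.1 (4): the fold normal form `(t, x) ↦ (t, Q(x))` has `df = (dt, 0)` on the
axis, whose image `ψ⁻¹(ℝ × 0)` is the round image; Milnor 1963, §2 for the chain rule in the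
chart, through the tree's `isMCriticalPt_comp_iff_of_fold_chart`.)
[cite: Hayano2011, Def. 2.1 (4)] -/
theorem stub_angularSubmersion :
    ∀ (X : Type) [TopologicalSpace X] [T2Space X] [SecondCountableTopology X] [CompactSpace X]
      [ChartedSpace (𝔼 4) X] [IsManifold (𝓡 4) ∞ X]
      (o : SmoothOrientation (𝓡 4) X) (f : X → 𝕊²),
      IsSimplifiedBrokenLefschetzFibration o f ∅ 0 →
      f '' ({p : X | ¬ Surjective (mfderiv (𝓡 4) (𝓡 2) f p)} \ (↑(∅ : Finset X) : Set X)) =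
        sphereEquator 1 →
      ∀ q : X, ¬ Surjective (mfderiv (𝓡 4) (𝓡 2) f q) →
        mfderiv (𝓡 4) 𝓘(ℝ, ℝ)
          ((fun y : 𝕊² => -(((f q : 𝕊²) : 𝔼 3) 1) * (y : 𝔼 3) 0 +
              (((f q : 𝕊²) : 𝔼 3) 0) * (y : 𝔼 3) 1) ∘ f) q ≠ 0 := by
  intro X _ _ _ _ _ _ o f hf hC q hq
  -- the fold chart at `q`
  obtain ⟨φ, ψ, hqφ, hφ0, hmaps, hφ, hφs, hψ, hψs, hmodel⟩ := hf.fold q hq (by simp)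
  have hfd : ∀ p, MDifferentiableAt (𝓡 4) (𝓡 2) f p := fun p =>
    (hf.contMDiff p).mdifferentiableAt (by simp)
  set e₀ : 𝔼 2 := EuclideanSpace.single 0 1 with he₀
  set a₀ : 𝔼 4 := EuclideanSpace.single 0 1 with ha₀
  have haxis0 : (φ q) 1 = 0 ∧ (φ q) 2 = 0 ∧ (φ q) 3 = 0 := by simp [hφ0]
  have hψf0 : ψ (f q) = 0 := by
    rw [apply_eq_foldNormalForm_of_fold_chart hmodel hqφ, hφ0]
    ext i; fin_cases i <;> simp
  have h0t : (0 : 𝔼 2) ∈ ψ.target := hψf0 ▸ ψ.map_source (hmaps hqφ)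
  have hsymm0 : ψ.symm 0 = f q := by rw [← hψf0, ψ.left_inv (hmaps hqφ)]
  -- the axis of the chart maps to the equator: `ψ⁻¹ (t, 0) = f (φ⁻¹ (t, 0, 0, 0)) ∈ {y₂ = 0}`
  have haxis : ∀ t : ℝ, t • a₀ ∈ φ.target →
      t • e₀ ∈ ψ.target ∧ ((ψ.symm (t • e₀) : 𝕊²) : 𝔼 3) 2 = 0 := by
    intro t ht
    have hq' : φ.symm (t • a₀) ∈ φ.source := φ.map_target ht
    have hφq : φ (φ.symm (t • a₀)) = t • a₀ := φ.right_inv ht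
    have hψq : ψ (f (φ.symm (t • a₀))) = t • e₀ := by
      rw [apply_eq_foldNormalForm_of_fold_chart hmodel hq', hφq]
      ext i; fin_cases i <;> simp [he₀, ha₀]
    have hfq : f (φ.symm (t • a₀)) ∈ ψ.source := hmaps hq'
    have hcrit : ¬ Surjective (mfderiv (𝓡 4) (𝓡 2) f (φ.symm (t • a₀))) := by
      rw [surjective_mfderiv_iff_of_fold_chart hmaps (hφ.of_le (by simp)) (hφs.of_le (by simp))
        (hψ.of_le (by simp)) (hψs.of_le (by simp)) hmodel hq' (hfd _), not_not, hφq]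
      simp [ha₀]
    have hmem : f (φ.symm (t • a₀)) ∈ sphereEquator 1 := by
      rw [← hC]; exact mem_image_of_mem f ⟨hcrit, by simp⟩
    refine ⟨hψq ▸ ψ.map_source hfq, ?_⟩
    rw [← hψq, ψ.left_inv hfq]
    exact (mem_sphereEquator_iff _).1 hmem
  -- the germ `c = ψ⁻¹` followed by the inclusion, a smooth map of the plane into `ℝ³`
  set c : 𝔼 2 → 𝔼 3 := fun u => ((ψ.symm u : 𝕊²) : 𝔼 3) with hcdef
  have hcs : ∀ u ∈ ψ.target, ContDiffAt ℝ ∞ c u := fun u hu => by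
    have h1 : ContMDiffAt (𝓡 2) (𝓡 2) ∞ ψ.symm u :=
      (hψs u hu).contMDiffAt (ψ.open_target.mem_nhds hu)
    have h2 : ContMDiffAt (𝓡 2) 𝓘(ℝ, 𝔼 3) ∞ c u := (contMDiff_coe_sphere _).comp u h1
    exact contMDiffAt_iff_contDiffAt.1 h2
  have hc0 : c 0 = ((f q : 𝕊²) : 𝔼 3) := by
    rw [hcdef]; exact congrArg Subtype.val hsymm0
  have hcd0 : DifferentiableAt ℝ c 0 := (hcs 0 h0t).differentiableAt (by simp)
  have hc2 : ContDiffAt ℝ 2 c 0 := (hcs 0 h0t).of_le (by norm_cast)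
  -- `Dc(0)` is injective: `ψ⁻¹` is a local diffeomorphism and `S² ⊆ ℝ³` an immersion
  have hinj : Injective (fderiv ℝ c 0) := by
    have hψd : ψ.MDifferentiable (𝓡 2) (𝓡 2) :=
      ⟨hψ.mdifferentiableOn (by simp), hψs.mdifferentiableOn (by simp)⟩
    have h1 : Injective (mfderiv (𝓡 2) (𝓡 2) ψ.symm 0) := hψd.symm.mfderiv_injective h0t
    have h2 : Injective (mfderiv (𝓡 2) 𝓘(ℝ, 𝔼 3) (Subtype.val : 𝕊² → 𝔼 3) (ψ.symm 0)) :=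
      mfderiv_coe_sphere_injective _
    have hcomp : HasMFDerivAt (𝓡 2) 𝓘(ℝ, 𝔼 3) c 0
        ((mfderiv (𝓡 2) 𝓘(ℝ, 𝔼 3) (Subtype.val : 𝕊² → 𝔼 3) (ψ.symm 0)).comp
          (mfderiv (𝓡 2) (𝓡 2) ψ.symm 0)) :=
      ((contMDiff_coe_sphere (m := 1) _).mdifferentiableAt one_ne_zero).hasMFDerivAt.comp 0
        ((hψd.symm.mdifferentiableAt h0t).hasMFDerivAt)
    have heq : fderiv ℝ c 0 = (mfderiv (𝓡 2) 𝓘(ℝ, 𝔼 3) (Subtype.val : 𝕊² → 𝔼 3)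
        (ψ.symm 0)).comp (mfderiv (𝓡 2) (𝓡 2) ψ.symm 0) := by
      rw [← mfderiv_eq_fderiv, hcomp.mfderiv]
    rw [heq]
    exact h2.comp h1
  -- the axis set of parameters, an open neighbourhood of `0`
  set U : Set ℝ := {t | t • a₀ ∈ φ.target} with hU
  have hUo : IsOpen U := φ.open_target.preimage (continuous_id.smul continuous_const)
  have h0U : (0 : ℝ) ∈ U := by
    show (0 : ℝ) • a₀ ∈ φ.target
    rw [zero_smul, ← hφ0]; exact φ.map_source hqφ
  have hUn : U ∈ 𝓝 (0 : ℝ) := hUo.mem_nhds h0U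
  -- the tangent vector `T = ∂₀ c (0)` of the round image at `f q`
  obtain ⟨T, hT⟩ : ∃ T, fderiv ℝ c 0 e₀ = T := ⟨_, rfl⟩
  -- it is horizontal (`T₂ = 0`): the axis is carried into the equator
  have hE : ∀ᶠ t in 𝓝 (0 : ℝ), c (t • e₀) 2 = 0 :=
    Filter.eventually_of_mem hUn fun t ht => (haxis t ht).2
  have hzT : T 2 = 0 := by
    rw [← hT]; exact SphereGerm.fderiv_single_zero_two hc2 hE
  -- it is tangent to the sphere at `c 0 = f q`
  have hS : ∀ᶠ z in 𝓝 (0 : 𝔼 2), ‖c z‖ = 1 :=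
    Filter.Eventually.of_forall fun z => norm_eq_of_mem_sphere (ψ.symm z)
  have horth : ⟪c 0, T⟫ = 0 := by
    rw [← hT]; exact SphereGerm.inner_fderiv_eq_zero hS hcd0 e₀
  -- it is non-zero
  have hT0 : T ≠ 0 := by
    intro hT0
    have h0 : fderiv ℝ c 0 e₀ = fderiv ℝ c 0 0 := by rw [map_zero, hT, hT0]
    have h1 := congrArg (fun v : 𝔼 2 => v 0) (hinj h0)
    simp [he₀] at h1
  -- coordinates of `f q = c 0 = (x, y, 0)`
  have hz₀ : (c 0) 2 = 0 := by
    have := (haxis 0 h0U).2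
    rwa [zero_smul] at this
  have hxy : (c 0) 0 ^ 2 + (c 0) 1 ^ 2 = 1 := by
    have h1 : ⟪c 0, c 0⟫ = 1 := by
      rw [real_inner_self_eq_norm_sq, norm_eq_of_mem_sphere (ψ.symm 0)]; norm_num
    rw [BandFoliation.inner_eq_three, hz₀] at h1
    linear_combination h1
  have hTorth : (c 0) 0 * T 0 + (c 0) 1 * T 1 = 0 := by
    rw [BandFoliation.inner_eq_three, hz₀] at horth
    linear_combination horth
  -- the angular functional as a linear form of `ℝ³` restricted to the sphere
  set Λ : 𝔼 3 →L[ℝ] ℝ := (-((c 0) 1)) • EuclideanSpace.proj (0 : Fin 3) +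
    ((c 0) 0) • EuclideanSpace.proj (1 : Fin 3) with hΛdef
  have hΛ : ∀ x : 𝔼 3, Λ x = -((c 0) 1) * x 0 + (c 0) 0 * x 1 := fun x => by
    simp [hΛdef]
  have hℓ : (fun y : 𝕊² => -(((f q : 𝕊²) : 𝔼 3) 1) * (y : 𝔼 3) 0 +
      (((f q : 𝕊²) : 𝔼 3) 0) * (y : 𝔼 3) 1) = fun w : 𝕊² => Λ w := by
    funext y; rw [hΛ, ← hc0]
  -- the derivative of `Λ ∘ c` at `0` in the axis direction is `Λ T`
  have hfirst : fderiv ℝ ((fun w : 𝕊² => Λ w) ∘ ψ.symm) 0 e₀ = Λ T := by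
    have h1 : HasFDerivAt ((fun w : 𝕊² => Λ w) ∘ ψ.symm) (Λ.comp (fderiv ℝ c 0)) 0 :=
      Λ.hasFDerivAt.comp 0 hcd0.hasFDerivAt
    rw [h1.fderiv, ← hT]; rfl
  rw [hℓ]
  change ¬ IsMCriticalPt (𝓡 4) ((fun w : 𝕊² => Λ w) ∘ f) q
  rw [isMCriticalPt_comp_iff_of_fold_chart hmaps hφ hφs hψs hmodel hf.contMDiff
    (contMDiff_apply_sphere Λ) hqφ haxis0, hψf0, hfirst, hΛ]
  intro h
  obtain ⟨hT00, hT10⟩ := eq_zero_and_eq_zero_of_orth hxy hTorth h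
  apply hT0
  ext i; fin_cases i
  · exact hT00
  · exact hT10
  · exact hzT

end Summit.SmoothPoincare4.SmoothPoincare4.Cruxes.RungOne.Sketch

end
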